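import Mathlib
import Summits.Ventures.LatticeQCDFlow.Scaling.U1SlabEigen
import Summits.Ventures.LatticeQCDFlow.Scaling.SlabChainLeading

/-!
# LatticeQCDFlow / Scaling — `U(1)` slab chain: the leading coefficient `2^{-(4τ+1)}` of the
# truncated plaquette–plaquette correlation at separation `τ`

HONEST FRAMING: exact (Metropolis-corrected) sampling algorithms for lattice gauge theory;
figures of merit are autocorrelation/cost numbers at stated couplings and volumes; no
continuum-physics claim.

Venture `LatticeQCDFlow` (cell pub-lqcd), topic `Scaling`, FANOUT row 30 (lean-1) — OUR WORK (LEAD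
LINE 230 (G3′)), lattice file 5 of the slab-chain proof of (LC) at every separation.
* `integral_mul_eq_integral_marginal` — marginal substitution for one free layer of a product
  space (generalises `SlabChain.integral_mul_eq_zero_of_update`): if `F` does not depend on the
  layer `i`, `∫ F(η) r(η_i, η_j) = ∫ F(η) (∫ r(e, η_j) de)`;
* `integral_chain_step` — one step along the arc with the eigenvalue `integral_xObs_mul_rho4`;
* **`integral_chain_xObs`** — for `1 ≤ τ ≤ n`:
  `∫ xObs(η_0) xObs(η_τ) ∏_{h<τ} ρ(η_h, η_{h+1}) dμ^{⊗(n+1)} = (1/16)^τ · (1/2) = 2^{-(4τ+1)}` —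
  the printed tube coefficient of the strong-coupling expansion
  [cite: MontvayMunster1994, §3.6.2 (3.437)] as a Haar-integral identity; this is the constant `b`
  of the slab-chain theorem `SlabChain.cov_tilt_jetEq` for `U(1)` at separation `τ`.
Elementary; nothing is cited as a fact; no `def`, no `sorry`.
-/

noncomputable section

open MeasureTheory Filter Finset
open Literature.MathematicalPhysics.QuantumFieldTheory
open Summit.Ventures.LatticeQCDFlow.Theory2.SlabChain (integral_mul_eq_zero_of_update chainProd)

namespace Summit.Ventures.LatticeQCDFlow.Theory2.Lattice.U1Layer

variable {d L : ℕ} [NeZero L] {a i j : Fin d}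

/-! ## 3. Iterating along the short arc: the leading coefficient `2^{-(4τ+1)}` -/

section Chain

/-- **Marginal substitution for one free layer** (generalises
`SlabChain.integral_mul_eq_zero_of_update`): if `F` does not depend on the layer `i` and `j ≠ i`,
then `∫ F(η) r(η_i, η_j) dν_E = ∫ F(η) m(η_j) dν_E` with `m(e') = ∫ r(e, e') dμ(e)`. [folklore] -/
theorem integral_mul_eq_integral_marginal {n : ℕ} {E : Type*} [MeasurableSpace E] (μ : Measure E)
    [IsProbabilityMeasure μ] {i j : Fin (n + 1)} (hij : j ≠ i)
    {F : (Fin (n + 1) → E) → ℂ} (hFm : Measurable F) {M : ℝ} (hFb : ∀ η, ‖F η‖ ≤ M)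
    (hF : ∀ η e, F (Function.update η i e) = F η)
    {r : E → E → ℂ} (hrm : Measurable (Function.uncurry r)) {Mr : ℝ} (hrb : ∀ e e', ‖r e e'‖ ≤ Mr) :
    ∫ η, F η * r (η i) (η j) ∂(Measure.pi fun _ : Fin (n + 1) => μ) =
      ∫ η, F η * (∫ e, r e (η j) ∂μ) ∂(Measure.pi fun _ : Fin (n + 1) => μ) := by
  -- the centred kernel has vanishing first marginal
  set m : E → ℂ := fun e' => ∫ e, r e e' ∂μ with hm
  have hmm : Measurable m := (hrm.stronglyMeasurable.integral_prod_left' (μ := μ)).measurable |> fun h => by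
    have : m = fun e' => ∫ e, Function.uncurry r (e, e') ∂μ := rfl
    rw [this]
    exact (hrm.stronglyMeasurable.integral_prod_left (μ := μ)).measurable
  have hmb : ∀ e', ‖m e'‖ ≤ Mr := fun e' => by
    have h := norm_integral_le_of_norm_le_const (μ := μ) (Eventually.of_forall fun e => hrb e e')
    simpa [hm] using h
  have hr' : ∀ e', ∫ e, (fun e e' => r e e' - m e') e e' ∂μ = 0 := by
    intro e'
    have hint : Integrable (fun e => r e e') μ :=
      Integrable.of_bound (hrm.comp (measurable_id.prodMk measurable_const)).aestronglyMeasurable _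
        (Eventually.of_forall fun e => hrb e e')
    simp only
    rw [integral_sub hint (integrable_const _), integral_const, probReal_univ, one_smul, hm, sub_self]
  have h0 := SlabChain.integral_mul_eq_zero_of_update μ hij hFm hFb hF
    (r := fun e e' => r e e' - m e') (hrm.sub (hmm.comp measurable_snd)) (Mr := Mr + Mr)
    (fun e e' => (norm_sub_le _ _).trans (add_le_add (hrb e e') (hmb e'))) hr'
  -- split the integral
  have hi1 : Integrable (fun η : Fin (n + 1) → E => F η * r (η i) (η j)) (Measure.pi fun _ => μ) :=
    Integrable.of_bound (hFm.mul (hrm.comp ((measurable_pi_apply i).prodMk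
      (measurable_pi_apply j)))).aestronglyMeasurable (M * Mr) (Eventually.of_forall fun η => by
        rw [norm_mul]
        exact mul_le_mul (hFb η) (hrb _ _) (norm_nonneg _) ((norm_nonneg _).trans (hFb η)))
  have hi2 : Integrable (fun η : Fin (n + 1) → E => F η * m (η j)) (Measure.pi fun _ => μ) :=
    Integrable.of_bound (hFm.mul (hmm.comp (measurable_pi_apply j))).aestronglyMeasurable (M * Mr)
      (Eventually.of_forall fun η => by
        rw [norm_mul]
        exact mul_le_mul (hFb η) (hmb _) (norm_nonneg _) ((norm_nonneg _).trans (hFb η)))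
  have hsub : ∫ η, F η * r (η i) (η j) ∂(Measure.pi fun _ : Fin (n + 1) => μ) -
      ∫ η, F η * m (η j) ∂(Measure.pi fun _ : Fin (n + 1) => μ) = 0 := by
    rw [← integral_sub hi1 hi2, ← h0]
    refine integral_congr_ae (Eventually.of_forall fun η => ?_)
    simp only
    ring
  exact sub_eq_zero.1 hsub

variable (hi : i ≠ a) (hj : j ≠ a) (hij : i ≠ j)
include hij

/-- **One step along the arc**: integrating the layer `k` replaces `xObs(η_k) ρ(η_k, η_{k+1})` by
`xObs(η_{k+1})/16`. [folklore] -/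
theorem integral_chain_step (hL : 2 ≤ L) {n : ℕ} {τ : Fin (n + 1)} {k : Fin (n + 1)}
    (hk : k.val < τ.val) :
    ∫ η, (xObs hi hj (η k) : ℂ) * (xObs hi hj (η τ) : ℂ) *
        chainProd (fun _ => rho4 (d := d) (L := L) (a := a)) (Finset.Ico k τ) η
        ∂(Measure.pi fun _ : Fin (n + 1) => Measure.pi fun _ : LEdge d L a => haarProbability Circle) =
      16⁻¹ * ∫ η, (xObs hi hj (η (k + 1)) : ℂ) * (xObs hi hj (η τ) : ℂ) *
        chainProd (fun _ => rho4 (d := d) (L := L) (a := a)) (Finset.Ico (k + 1) τ) η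
        ∂(Measure.pi fun _ : Fin (n + 1) => Measure.pi fun _ : LEdge d L a => haarProbability Circle) := by
  have hkn : k.val < n := by have := τ.isLt; omega
  have hk1 : (k + 1).val = k.val + 1 := SlabChain.val_add_one_of_val_lt hkn
  have hkmem : k ∈ Finset.Ico k τ := Finset.mem_Ico.2 ⟨le_rfl, Fin.lt_def.2 hk⟩
  have hIco : (Finset.Ico k τ).erase k = Finset.Ico (k + 1) τ := by
    ext h
    simp only [Finset.mem_erase, Finset.mem_Ico, Fin.le_def, Fin.lt_def, hk1, ne_eq, Fin.ext_iff]
    omega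
  -- bounds and measurability of the pieces
  have hxm : Measurable fun e : LEdge d L a → Circle => (xObs hi hj e : ℂ) :=
    (Complex.continuous_ofReal.comp (continuous_xObs hi hj)).measurable
  have hxb : ∀ e : LEdge d L a → Circle, ‖(xObs hi hj e : ℂ)‖ ≤ 1 := fun e => by
    rw [Complex.norm_real, Real.norm_eq_abs]; exact abs_xObs_le hi hj e
  have hρm : ∀ h : Fin (n + 1), Measurable (Function.uncurry ((fun _ => rho4 (d := d) (L := L) (a := a)) h)) :=
    fun _ => measurable_rho4
  have hρb : ∀ (h : Fin (n + 1)) (e e' : LEdge d L a → Circle),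
      ‖(fun _ => rho4 (d := d) (L := L) (a := a)) h e e'‖ ≤
        ((Fintype.card (LEdge d L a) : ℝ) ^ 4 + ‖c4 d L a‖) / 24 := fun _ e e' => norm_rho4_le e e'
  -- rewrite the integrand as `F(η) · r(η_k, η_{k+1})` with `F` free of the layer `k`
  set F : (Fin (n + 1) → LEdge d L a → Circle) → ℂ := fun η =>
    (xObs hi hj (η τ) : ℂ) * chainProd (fun _ => rho4 (d := d) (L := L) (a := a)) (Finset.Ico (k + 1) τ) η
    with hFdef
  have hsplit : ∀ η : Fin (n + 1) → LEdge d L a → Circle,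
      (xObs hi hj (η k) : ℂ) * (xObs hi hj (η τ) : ℂ) *
        chainProd (fun _ => rho4 (d := d) (L := L) (a := a)) (Finset.Ico k τ) η =
      F η * ((fun e e' => (xObs hi hj e : ℂ) * rho4 e e') (η k) (η (k + 1))) := by
    intro η
    simp only [hFdef, chainProd]
    rw [← Finset.mul_prod_erase _ _ hkmem, hIco]
    ring
  simp_rw [hsplit]
  have hτk : τ ≠ k := fun h => by rw [h] at hk; exact lt_irrefl _ hk
  have hk1k : k + 1 ≠ k := fun h => by
    have := congrArg Fin.val h; rw [hk1] at this; omega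
  have hFm : Measurable F := (hxm.comp (measurable_pi_apply τ)).mul (SlabChain.measurable_chainProd hρm _)
  have hFb : ∀ η, ‖F η‖ ≤ 1 * (((Fintype.card (LEdge d L a) : ℝ) ^ 4 + ‖c4 d L a‖) / 24) ^
      (Finset.Ico (k + 1) τ).card := fun η => by
    rw [hFdef, norm_mul]
    exact mul_le_mul (hxb _) (SlabChain.norm_chainProd_le hρb _ η) (norm_nonneg _) zero_le_one
  have hne1 : ∀ h ∈ Finset.Ico (k + 1) τ, h ≠ k := by
    intro h hh heq
    have := (Finset.mem_Ico.1 hh).1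
    rw [Fin.le_def, hk1, heq] at this
    omega
  have hne2 : ∀ h ∈ Finset.Ico (k + 1) τ, h + 1 ≠ k := by
    intro h hh heq
    have h1 := (Finset.mem_Ico.1 hh).1
    have h2 := (Finset.mem_Ico.1 hh).2
    rw [Fin.le_def, hk1] at h1
    have hv : (h + 1).val = h.val + 1 :=
      SlabChain.val_add_one_of_val_lt (by rw [Fin.lt_def] at h2; have := τ.isLt; omega)
    have := congrArg Fin.val heq
    rw [hv] at this
    omega
  have hF : ∀ η e, F (Function.update η k e) = F η := by
    intro η e
    simp only [hFdef]
    rw [Function.update_of_ne hτk, SlabChain.chainProd_update hne1 hne2]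
  have hrm : Measurable (Function.uncurry fun e e' : LEdge d L a → Circle => (xObs hi hj e : ℂ) * rho4 e e') :=
    (hxm.comp measurable_fst).mul measurable_rho4
  have hrb : ∀ e e' : LEdge d L a → Circle, ‖(xObs hi hj e : ℂ) * rho4 e e'‖ ≤
      1 * (((Fintype.card (LEdge d L a) : ℝ) ^ 4 + ‖c4 d L a‖) / 24) := fun e e' => by
    rw [norm_mul]; exact mul_le_mul (hxb e) (norm_rho4_le e e') (norm_nonneg _) zero_le_one
  rw [integral_mul_eq_integral_marginal (Measure.pi fun _ : LEdge d L a => haarProbability Circle)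
    hk1k hFm hFb hF hrm hrb]
  simp_rw [integral_xObs_mul_rho4 hi hj hij hL]
  rw [← integral_const_mul]
  refine integral_congr_ae (Eventually.of_forall fun η => ?_)
  simp only [hFdef]
  ring

/-- **THE LEADING COEFFICIENT**: for `1 ≤ τ ≤ n` and torus side `L ≥ 2`,
`∫ xObs(η_0) xObs(η_τ) ∏_{h<τ} ρ(η_h, η_{h+1}) dμ^{⊗(n+1)} = (1/16)^τ · (1/2) = 2^{-(4τ+1)}`, the
tube coefficient of the strong-coupling expansion [cite: MontvayMunster1994, §3.6.2 (3.437)] as a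
Haar-integral identity. [folklore] -/
theorem integral_chain_xObs (hL : 2 ≤ L) {n : ℕ} {τ : Fin (n + 1)} (hτ1 : 1 ≤ τ.val) :
    ∫ η, (xObs hi hj (η 0) : ℂ) * (xObs hi hj (η τ) : ℂ) *
        chainProd (fun _ => rho4 (d := d) (L := L) (a := a)) (Finset.Iio τ) η
        ∂(Measure.pi fun _ : Fin (n + 1) => Measure.pi fun _ : LEdge d L a => haarProbability Circle) =
      (16⁻¹ : ℂ) ^ τ.val * (1 / 2) := by
  -- induction along the arc: `Q k = 16^{-(τ-k)} Q τ`
  have hstep : ∀ m : ℕ, ∀ k : Fin (n + 1), k.val + m = τ.val →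
      ∫ η, (xObs hi hj (η k) : ℂ) * (xObs hi hj (η τ) : ℂ) *
          chainProd (fun _ => rho4 (d := d) (L := L) (a := a)) (Finset.Ico k τ) η
          ∂(Measure.pi fun _ : Fin (n + 1) => Measure.pi fun _ : LEdge d L a => haarProbability Circle) =
        (16⁻¹ : ℂ) ^ m * ∫ η, (xObs hi hj (η τ) : ℂ) ^ 2
          ∂(Measure.pi fun _ : Fin (n + 1) => Measure.pi fun _ : LEdge d L a => haarProbability Circle) := by
    intro m
    induction m with
    | zero =>
        intro k hk
        have hkτ : k = τ := Fin.ext (by omega)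
        subst hkτ
        rw [Finset.Ico_self, pow_zero, one_mul]
        refine integral_congr_ae (Eventually.of_forall fun η => ?_)
        simp [chainProd, sq]
    | succ m ih =>
        intro k hk
        have hkτ : k.val < τ.val := by omega
        rw [integral_chain_step hi hj hij hL hkτ, ih (k + 1) (by
          rw [SlabChain.val_add_one_of_val_lt (by have := τ.isLt; omega)]; omega), ← mul_assoc,
          ← pow_succ']
  have h0 : Finset.Iio τ = Finset.Ico (0 : Fin (n + 1)) τ := by
    ext h; simp
  rw [h0, hstep τ.val 0 (by simp)]
  congr 1
  -- the marginal at the layer `τ`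
  have hmp := MeasureTheory.measurePreserving_eval
    (fun _ : Fin (n + 1) => Measure.pi fun _ : LEdge d L a => haarProbability Circle) τ
  have hg : AEStronglyMeasurable (fun e : LEdge d L a → Circle => (xObs hi hj e : ℂ) ^ 2)
      ((Measure.pi fun _ : Fin (n + 1) => Measure.pi fun _ : LEdge d L a => haarProbability Circle).map
        (Function.eval τ)) :=
    ((Complex.continuous_ofReal.comp (continuous_xObs hi hj)).pow 2).aestronglyMeasurable
  have h1 := integral_map hmp.measurable.aemeasurable hg
  rw [hmp.map_eq] at h1
  rw [← integral_xObs_sq hi hj hij hL, h1]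

end Chain

end Summit.Ventures.LatticeQCDFlow.Theory2.Lattice.U1Layer

end
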